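import Summits.ResolutionOfSingularities.ResolutionOfSingularities.Theorems.ValuativeLuAlphaPTorsorAPFlagAssembly
import Summits.ResolutionOfSingularities.ResolutionOfSingularities.Theorems.ValuativeLuAlphaPTorsorRankOne
import Summits.ResolutionOfSingularities.ResolutionOfSingularities.Theorems.ValuativeLuAlphaPTorsorAdaptedValueStep
import HarnessLib

/-!
# `LuAlphaPTorsor` along zero-dimensional Abhyankar places of ANY rank (the F⁶ᵇ core), modulo F⁶ᵛ

Crux `Valuative.LuAlphaPTorsor` (stmt-ResolutionOfSingularities-0641), line `pfaff-line-log-final-forms`,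
lead seat c4 — the conclusion of the attack on the rank `≥ 2` Abhyankar core
`stub_abhyankarHigherRankCore` (reshape v6.3), as the rank-one `…RankOne` with FLAG-ADAPTED
charts: absorption of finitely many elements of `O` (`ap_flag_chart_absorbing`: the any-rank
monomialization `ap_adaptedPerron_flag` twice + inversion of units), then
`abhyankarHigherRankCore_of_F6v` with the registered statement of `stub_abhyankarHigherRankCore`
(its hypotheses "not rank one", inseparability, "not discrete", "no unit derivative", "not a
`p`-th power" are NOT used: the proof works at every zero-dimensional Abhyankar place), MODULO
the value step F⁶ᵛ `stub_adaptedValueStep` (hypothesis), and the relative local uniformization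
corollary. Anchor (closed form): `ap_flag_final_anchor`. [folklore]
-/

set_option linter.dupNamespace false

open IsLocalRing

namespace Summit.ResolutionOfSingularities.ResolutionOfSingularities.Theorems.PfaffLine

open Literature.AlgebraicGeometry.Resolution

/-- Anchor (closed form): a non-zero element of `O` has positive value. [folklore] -/
theorem ap_flag_final_anchor : ∀ {K : Type} [Field K] (O : ValuationSubring K) (z : K), z ≠ 0 → 0 < O.valuation z := by
  intro K _ O z hz
  exact (Valuation.pos_iff _).mpr hz

section Final

variable {k K : Type} [Field k] [Field K] [Algebra k K]

/-- **Absorption on flag-adapted charts** (any rank): given a flag-adapted chart `(R, x, lv)` of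
`K` with value torsion (`K = Frac R`) and finitely many non-zero `a_j ∈ O`, a flag-adapted chart
`(R', x', lv')` with `R ≤ R' ∋ a_j`. [folklore] -/
theorem ap_flag_chart_absorbing (O : ValuationSubring K) (hk : ∀ c : k, algebraMap k K c ∈ O)
    {n : ℕ} (R : Subalgebra k K) (hRO : R.toSubring ≤ O.toSubring) (x : Fin n → K)
    (hx : ∀ i, x i ∈ R) (lv : Fin n → ℕ) (hflag : FlagAdaptedChart O R hRO x hx lv)
    (htors : ∀ z : K, z ≠ 0 → ∃ N : ℕ, N ≠ 0 ∧ ∃ m : Fin n → ℤ, O.valuation z ^ N = ∏ i, O.valuation (x i) ^ (m i))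
    (hfrac : ∀ z : K, z ∈ Subfield.closure (R : Set K))
    {m : ℕ} (a : Fin m → K) (haO : ∀ j, a j ∈ O) (ha0 : ∀ j, a j ≠ 0) :
    ∃ (R' : Subalgebra k K) (hR'O : R'.toSubring ≤ O.toSubring) (x' : Fin n → K)
      (hx' : ∀ i, x' i ∈ R') (lv' : Fin n → ℕ), R ≤ R' ∧ (∀ j, a j ∈ R') ∧
      FlagAdaptedChart O R' hR'O x' hx' lv' := by
  obtain ⟨⟨hfg, hx0, hspan, hind, -, -⟩, -⟩ := id hflag
  classical
  -- numerators and denominators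
  have hnd : ∀ j, ∃ num den : K, num ∈ R ∧ den ∈ R ∧ num ≠ 0 ∧ den ≠ 0 ∧ a j = num / den :=
    fun j => exists_num_den_of_mem_closure R (hfrac (a j)) (ha0 j)
  choose num den hnumR hdenR hnum0 hden0 haeq using hnd
  -- monomialize the numerators, then the denominators
  obtain ⟨R1, hR1O, x1, hx1, lv1, hRR1, -, hflag1, -, hxd1, hmono1, -⟩ :=
    ap_adaptedPerron_flag n k K O hk R hRO x hx lv hflag htors m num (fun j => ⟨hnumR j, hnum0 j⟩) 0
      (fun j => Fin.elim0 j) (fun j => Fin.elim0 j)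
  have hx10 : ∀ i, x1 i ≠ 0 := hflag1.1.2.1
  have htors1 : ∀ z : K, z ≠ 0 → ∃ N : ℕ, N ≠ 0 ∧ ∃ m : Fin n → ℤ, O.valuation z ^ N = ∏ i, O.valuation (x1 i) ^ (m i) :=
    ap_flag_htors_transfer O x x1 hx10 (fun i => by obtain ⟨d, hd⟩ := hxd1 i; exact ⟨d, 1, by rw [map_one], by rw [hd, mul_one]⟩) htors
  obtain ⟨R2, hR2O, x2, hx2, lv2, hR1R2, -, hflag2, -, hx1x2, hmono2, -⟩ :=
    ap_adaptedPerron_flag n k K O hk R1 hR1O x1 hx1 lv1 hflag1 htors1 m den (fun j => ⟨hRR1 (hdenR j), hden0 j⟩)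
      0 (fun j => Fin.elim0 j) (fun j => Fin.elim0 j)
  have hx20 : ∀ i, x2 i ≠ 0 := hflag2.1.2.1
  have htors2 : ∀ z : K, z ≠ 0 → ∃ N : ℕ, N ≠ 0 ∧ ∃ m : Fin n → ℤ, O.valuation z ^ N = ∏ i, O.valuation (x2 i) ^ (m i) :=
    ap_flag_htors_transfer O x1 x2 hx20 (fun i => by obtain ⟨d, hd⟩ := hx1x2 i; exact ⟨d, 1, by rw [map_one], by rw [hd, mul_one]⟩) htors1
  choose α ua huaR1 hua1 hnum using hmono1
  choose β ub hubR2 hub1 hden using hmono2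
  choose d hd using hx1x2
  -- numerators as monomials in `x2`
  let α' : Fin m → Fin n → ℕ := fun j i' => ∑ i, α j i * d i i'
  have hnum' : ∀ j, num j = (∏ i, x2 i ^ (α' j i)) * ua j := by
    intro j
    rw [hnum j]
    congr 1
    have h1 : (∏ i, x1 i ^ (α j i)) = ∏ i, (∏ i', x2 i' ^ (d i i')) ^ (α j i) :=
      Finset.prod_congr rfl fun i _ => by rw [hd i]
    rw [h1]
    simp_rw [← Finset.prod_pow, ← pow_mul]
    rw [Finset.prod_comm]
    refine Finset.prod_congr rfl fun i' _ => ?_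
    rw [Finset.prod_pow_eq_pow_sum]
    refine congrArg _ (Finset.sum_congr rfl fun i _ => ?_)
    ring
  -- invert the product of the denominators' units
  set U : K := ∏ j, ub j with hU
  have hUR2 : U ∈ R2 := R2.prod_mem fun j _ => hubR2 j
  have hU1 : O.valuation U = 1 := by
    rw [hU, map_prod]
    exact Finset.prod_eq_one fun j _ => hub1 j
  obtain ⟨R3, hR3O, hx3, -, hR2R3, hUinv, -, -, hflag3⟩ :=
    ap_flag_adjoin_inv O hk R2 hR2O x2 hx2 lv2 hflag2 U hUR2 hU1
  have hub0 : ∀ j, ub j ≠ 0 := fun j h => by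
    have := hub1 j; rw [h, map_zero] at this; exact zero_ne_one this
  have hubinv : ∀ j, (ub j)⁻¹ ∈ R3 := by
    intro j
    have hP0 : (∏ j' ∈ Finset.univ.erase j, ub j') ≠ 0 :=
      Finset.prod_ne_zero_iff.mpr fun j' _ => hub0 j'
    have h : (ub j)⁻¹ = U⁻¹ * ∏ j' ∈ Finset.univ.erase j, ub j' := by
      rw [hU, ← Finset.mul_prod_erase _ _ (Finset.mem_univ j), mul_inv, mul_assoc,
        inv_mul_cancel₀ hP0, mul_one]
    rw [h]
    exact R3.mul_mem hUinv (R3.prod_mem fun j' _ => hR2R3 (hubR2 j'))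
  -- the exponent differences have value `≤ 1`
  let h : Fin m → Fin n → ℤ := fun j i => (α' j i : ℤ) - (β j i : ℤ)
  have hv0 : ∀ i, O.valuation (x2 i) ≠ 0 := fun i => (map_ne_zero _).mpr (hx20 i)
  have hah : ∀ j, a j = (∏ i, x2 i ^ (h j i)) * (ua j * (ub j)⁻¹) := by
    intro j
    rw [haeq j, hnum' j, hden j]
    have hsplit : (∏ i, x2 i ^ (h j i)) = (∏ i, x2 i ^ (α' j i)) / ∏ i, x2 i ^ (β j i) := by
      rw [eq_div_iff (Finset.prod_ne_zero_iff.mpr fun i _ => pow_ne_zero _ (hx20 i)),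
        ← Finset.prod_mul_distrib]
      refine Finset.prod_congr rfl fun i _ => ?_
      rw [← zpow_natCast (x2 i) (β j i), ← zpow_add₀ (hx20 i), ← zpow_natCast]
      simp [h]
    rw [hsplit]
    field_simp
  have hhle : ∀ j, (∏ i, O.valuation (x2 i) ^ (h j i)) ≤ 1 := by
    intro j
    have h1 : O.valuation (a j) = ∏ i, O.valuation (x2 i) ^ (h j i) := by
      rw [hah j, map_mul, map_mul, map_inv₀, hua1, hub1, inv_one, mul_one, mul_one, map_prod]
      exact Finset.prod_congr rfl fun i _ => map_zpow₀ _ _ _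
    rw [← h1]
    exact (O.valuation_le_one_iff _).mpr (haO j)
  -- monomialize the differences
  obtain ⟨R4, hR4O, x4, hx4, lv4, hR3R4, -, hflag4, -, -, -, hexp⟩ :=
    ap_adaptedPerron_flag n k K O hk R3 hR3O x2 hx3 lv2 hflag3 htors2 0 (fun j => Fin.elim0 j)
      (fun j => Fin.elim0 j) m h hhle
  refine ⟨R4, hR4O, x4, hx4, lv4, hRR1.trans (hR1R2.trans (hR2R3.trans hR3R4)), fun j => ?_, hflag4⟩
  obtain ⟨e, he⟩ := hexp j
  rw [hah j, he]
  exact R4.mul_mem (R4.prod_mem fun i _ => R4.pow_mem (hx4 i) _)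
    (R4.mul_mem (hR3R4 (hR2R3 (hR1R2 (huaR1 j)))) (hR3R4 (hubinv j)))


variable (hF6v : ∀ p : ℕ, p.Prime → (∀ (Γ₀ : Type) [LinearOrderedCommGroupWithZero Γ₀] (n : ℕ) (τ : Fin n → Γ₀), (∀ i, τ i ≠ 0) → (∀ m : Fin n → ℤ, (∏ i, τ i ^ (m i)) = 1 → m = 0) → ∀ (H : Finset (Fin n → ℤ)), (∀ h ∈ H, (∏ i, τ i ^ (h i)) ≤ 1) → ∃ (C D : Matrix (Fin n) (Fin n) ℤ), C * D = 1 ∧ D * C = 1 ∧ (∀ j, (∏ i, τ i ^ (C j i)) < 1) ∧ (∀ h ∈ H, ∃ e : Fin n → ℕ, ∀ i, h i = ∑ j, (e j : ℤ) * C j i) ∧ ∃ lv : Fin n → ℕ, FlagAdaptedValues (fun j => ∏ i, τ i ^ (C j i)) lv) → ∀ (k K : Type) [Field k] [Field K] [Algebra k K] (O : ValuationSubring K) (n : ℕ) (R : Subalgebra k K) (hRO : R.toSubring ≤ O.toSubring) (x : Fin n → K) (hx : ∀ i, x i ∈ R) (lv : Fin n → ℕ), FlagAdaptedChart O R hRO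 x hx lv → (∀ z : K, z ≠ 0 → ∃ N : ℕ, N ≠ 0 ∧ ∃ m : Fin n → ℤ, O.valuation z ^ N = ∏ i, O.valuation (x i) ^ (m i)) → ∀ (t u : K) (α : Fin n → ℕ), u ∈ R → u⁻¹ ∈ R → O.valuation u = 1 → t ^ p = (∏ i, x i ^ (α i)) * u → (∀ m : Fin n → ℤ, O.valuation t ≠ ∏ i, O.valuation (x i) ^ (m i)) → ∃ (R' : Subalgebra k K) (hR'O : R'.toSubring ≤ O.toSubring) (y : Fin n → K) (hy : ∀ i, y i ∈ R') (lv' : Fin n → ℕ), R ≤ R' ∧ t ∈ R' ∧ ((R' : Set K) ⊆ Subfield.closure ((R : Set K) ∪ {t})) ∧ FlagAdaptedChart O R' hR'O y hy lv' ∧ (∀ i, ∃ (d : Fin n → ℕ) (w : K), w ∈ R' ∧ O.valuation w = 1 ∧ x i = (∏ j, y j ^ (d j)) * w))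

include hF6v

omit [Field k] [Field K] [Algebra k K] in
/-- **The rank ≥ 2 Abhyankar core, modulo the value step F⁶ᵛ** — in fact `LuAlphaPTorsor` along
EVERY zero-dimensional Abhyankar place of any rank, every ground field of characteristic `p`
(the registered statement of `stub_abhyankarHigherRankCore`; its hypotheses beyond
zero-dimensionality and the Abhyankar property are not used). [folklore] -/
theorem abhyankarHigherRankCore_of_F6v : ∀ p : ℕ, p.Prime → ∀ (k K : Type) [Field k] [CharP k p] [Field K] [Algebra k K] (O : ValuationSubring K) (A₀ : Subalgebra k K) (h₀ : A₀.toSubring ≤ O.toSubring) (t : K), A₀.FG → ∀ (htp : t ^ p ∈ A₀), IsFractionRing (Algebra.adjoin k (insert t (A₀ : Set K))) K → IsRegularLocalRing (Localization.AtPrime (Ideal.comap (Subring.inclusion h₀) (IsLocalRing.maximalIdeal O))) → (Ideal.comap (Subring.inclusion h₀) (IsLocalRing.maximalIdeal O)).IsMaximal → (∀ x : K, x ∈ O → ∃ f : Polynomial k, f ≠ 0 ∧ Polynomial.aeval x f ∈ O.nonunits) → ¬ ringKrullDim (Localization.AtPrime (Ideal.comap (Subring.inclusion h₀) (IsLocalRing.maximalIdeal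 O))) ≤ 2 → Literature.AlgebraicGeometry.Resolution.IsAbhyankarPlace O (algebraMap k K).fieldRange ⊤ → ¬ (∀ z w : K, O.valuation z < 1 → w ≠ 0 → ∃ N : ℕ, O.valuation z ^ N < O.valuation w) → ¬ Literature.AlgebraicGeometry.Resolution.SeparablyGeneratedOver (Literature.AlgebraicGeometry.Resolution.resField O (algebraMap k K).fieldRange) (Literature.AlgebraicGeometry.Resolution.resField O ⊤) → ¬ Literature.AlgebraicGeometry.Resolution.SeparablyGeneratedOver (Literature.AlgebraicGeometry.Resolution.resField O (algebraMap k K).fieldRange) (Literature.AlgebraicGeometry.Resolution.resField O (Subfield.closure (A₀ : Set K))) → ¬ PerfectField k → ¬ (∃ π : K, π ≠ 0 ∧ O.valuation π < 1 ∧ ∀ z : K, z ≠ 0 → ∃ n : ℤ, O.valuation z = O.valuation π ^ n) → (∀ δ : Derivation ℤ (Localization.AtPrime (Ideal.comap (Subring.inclusion h₀) (IsLocalRing.maximalIdeal O))) (Localization.AtPrime (Ideal.comap (Subring.inclusion h₀) (IsLocalRing.maximalIdeal O))), ¬ IsUnit (δ (algebraMap A₀.toSubring (Localization.AtPrime (Ideal.comap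 (Subring.inclusion h₀) (IsLocalRing.maximalIdeal O))) ⟨t ^ p, htp⟩))) → (∀ c : Localization.AtPrime (Ideal.comap (Subring.inclusion h₀) (IsLocalRing.maximalIdeal O)), algebraMap A₀.toSubring (Localization.AtPrime (Ideal.comap (Subring.inclusion h₀) (IsLocalRing.maximalIdeal O))) ⟨t ^ p, htp⟩ ≠ c ^ p) → ∃ (A : Subalgebra k K) (h : A.toSubring ≤ O.toSubring), A₀ ≤ A ∧ t ∈ A ∧ A.FG ∧ IsFractionRing A K ∧ IsRegularLocalRing (Localization.AtPrime (Ideal.comap (Subring.inclusion h) (IsLocalRing.maximalIdeal O))) := by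
  intro p hp k K _ _ _ _ O A₀ h₀ t hfg htp hfr _ _ hzd _ hA _ _ _ _ _ _ _
  classical
  have hk : ∀ c : k, algebraMap k K c ∈ O := fun c => h₀ (A₀.algebraMap_mem c)
  have htO : t ∈ O := mem_valuationSubring_of_pow_mem O hp.ne_zero (h₀ htp)
  -- generators: `K = k(g ∪ {t})` for algebra generators `g` of `A₀`
  obtain ⟨g, hg⟩ := hfg
  have hgA₀ : ∀ z ∈ g, z ∈ A₀ := fun z hz => by rw [← hg]; exact Algebra.subset_adjoin hz
  set s : Finset K := insert t g with hsdef
  have hs : IntermediateField.adjoin k (s : Set K) = ⊤ := by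
    rw [eq_top_iff]
    intro z _
    haveI := hfr
    obtain ⟨a, b, -, rfl⟩ :=
      IsFractionRing.div_surjective (A := Algebra.adjoin k (insert t (A₀ : Set K))) z
    have hle : Algebra.adjoin k (insert t (A₀ : Set K)) ≤
        (IntermediateField.adjoin k (s : Set K)).toSubalgebra := by
      rw [← hg, Algebra.adjoin_insert_adjoin, hsdef, Finset.coe_insert]
      exact IntermediateField.algebra_adjoin_le_adjoin k _
    exact div_mem (hle a.2) (hle b.2)
  -- a very good chart of `K`
  obtain ⟨n, R, hRO, x, hx, lv, hfrac, hflag, htors, htr⟩ :=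
    ap_flag_chart_top hF6v hp O hk hzd hA s hs
  -- absorb the non-zero elements of `s`
  set s₁ : Finset K := s.filter fun z => z ≠ 0 with hs₁
  let a : Fin s₁.card → K := fun j => (s₁.equivFin.symm j : K)
  have has₁ : ∀ j, a j ∈ s₁ := fun j => (s₁.equivFin.symm j).2
  have haO : ∀ j, a j ∈ O := fun j => by
    have h := (Finset.mem_filter.mp (has₁ j)).1
    rcases Finset.mem_insert.mp h with h | h
    · rw [h]; exact htO
    · exact h₀ (hgA₀ _ h)
  have ha0 : ∀ j, a j ≠ 0 := fun j => (Finset.mem_filter.mp (has₁ j)).2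
  obtain ⟨A, hAO, x', hx', lv', hRA, haA, hflagA⟩ :=
    ap_flag_chart_absorbing O hk R hRO x hx lv hflag htors hfrac a haO ha0
  have hAfg : A.FG := hflagA.1.1
  have hspanA := hflagA.1.2.2.1
  -- every element of `s` lies in `A`
  have hsA : ∀ z ∈ s, z ∈ A := by
    intro z hz
    by_cases hz0 : z = 0
    · rw [hz0]; exact A.zero_mem
    · have hz₁ : z ∈ s₁ := Finset.mem_filter.mpr ⟨hz, hz0⟩
      have h := haA (s₁.equivFin ⟨z, hz₁⟩)
      simpa [a] using h
  have hfracA : ∀ z : K, ∃ a' ∈ A.toSubring, ∃ b' ∈ A.toSubring, z = a' / b' := by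
    intro z
    have hz : z ∈ Subfield.closure (A : Set K) := Subfield.closure_mono (fun w hw => hRA hw) (hfrac z)
    obtain ⟨y, hy, w, hw, rfl⟩ := Subfield.mem_closure_iff.mp hz
    have hcl : Subring.closure (A : Set K) = A.toSubring := Subring.closure_eq A.toSubring
    rw [hcl] at hy hw
    exact ⟨y, hy, w, hw, rfl⟩
  haveI hfrA : IsFractionRing A K := isFractionRing_of_forall_exists_div A.toSubring hfracA
  refine ⟨A, hAO, ?_, hsA t (Finset.mem_insert_self t g), hAfg, hfrA, ?_⟩
  · rw [← hg, Algebra.adjoin_le_iff]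
    exact fun z hz => hsA z (Finset.mem_insert_of_mem hz)
  · exact isRegularLocalRing_of_chart k K O hzd n A hAO x' hx' hAfg hfrA hspanA htr


omit [Field k] [Field K] [Algebra k K] in
/-- **Relative local uniformization at every zero-dimensional Abhyankar place of ANY rank, every
ground field of characteristic `p`, modulo F⁶ᵛ**. [folklore] -/
theorem relLU_zeroDim_abhyankar_of_F6v : ∀ p : ℕ, p.Prime → ∀ (k K : Type) [Field k] [CharP k p] [Field K] [Algebra k K] (O : ValuationSubring K), (∀ c : k, algebraMap k K c ∈ O) → (⊤ : IntermediateField k K).FG → (∀ x : K, x ∈ O → ∃ f : Polynomial k, f ≠ 0 ∧ Polynomial.aeval x f ∈ O.nonunits) → Literature.AlgebraicGeometry.Resolution.IsAbhyankarPlace O (algebraMap k K).fieldRange ⊤ → ∀ (S : Subalgebra k K), S.FG → S.toSubring ≤ O.toSubring → ∃ (A : Subalgebra k K) (h : A.toSubring ≤ O.toSubring), S ≤ A ∧ A.FG ∧ IsFractionRing A K ∧ IsRegularLocalRing (Localization.AtPrime (Ideal.comap (Subring.inclusion h) (IsLocalRing.maximalIdeal O))) := by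
  intro p hp k K _ _ _ _ O hk htopfg hzd hA S hSfg hSO
  classical
  obtain ⟨s, hs⟩ := htopfg
  obtain ⟨g, hg⟩ := hSfg
  have hgS : ∀ z ∈ g, z ∈ S := fun z hz => by rw [← hg]; exact Algebra.subset_adjoin hz
  -- a very good chart of `K`
  obtain ⟨n, R, hRO, x, hx, lv, hfrac, hflag, htors, htr⟩ :=
    ap_flag_chart_top hF6v hp O hk hzd hA s hs
  -- absorb the non-zero generators of `S`
  set g₁ : Finset K := g.filter fun z => z ≠ 0 with hg₁
  let a : Fin g₁.card → K := fun j => (g₁.equivFin.symm j : K)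
  have hag₁ : ∀ j, a j ∈ g₁ := fun j => (g₁.equivFin.symm j).2
  have haO : ∀ j, a j ∈ O := fun j => hSO (hgS _ (Finset.mem_filter.mp (hag₁ j)).1)
  have ha0 : ∀ j, a j ≠ 0 := fun j => (Finset.mem_filter.mp (hag₁ j)).2
  obtain ⟨A, hAO, x', hx', lv', hRA, haA, hflagA⟩ :=
    ap_flag_chart_absorbing O hk R hRO x hx lv hflag htors hfrac a haO ha0
  have hAfg : A.FG := hflagA.1.1
  have hspanA := hflagA.1.2.2.1
  have hgA : ∀ z ∈ g, z ∈ A := by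
    intro z hz
    by_cases hz0 : z = 0
    · rw [hz0]; exact A.zero_mem
    · have hz₁ : z ∈ g₁ := Finset.mem_filter.mpr ⟨hz, hz0⟩
      have h := haA (g₁.equivFin ⟨z, hz₁⟩)
      simpa [a] using h
  have hfracA : ∀ z : K, ∃ a' ∈ A.toSubring, ∃ b' ∈ A.toSubring, z = a' / b' := by
    intro z
    have hz : z ∈ Subfield.closure (A : Set K) := Subfield.closure_mono (fun w hw => hRA hw) (hfrac z)
    obtain ⟨y, hy, w, hw, rfl⟩ := Subfield.mem_closure_iff.mp hz
    have hcl : Subring.closure (A : Set K) = A.toSubring := Subring.closure_eq A.toSubring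
    rw [hcl] at hy hw
    exact ⟨y, hy, w, hw, rfl⟩
  haveI hfrA : IsFractionRing A K := isFractionRing_of_forall_exists_div A.toSubring hfracA
  refine ⟨A, hAO, ?_, hAfg, hfrA, isRegularLocalRing_of_chart k K O hzd n A hAO x' hx' hAfg hfrA hspanA htr⟩
  rw [← hg, Algebra.adjoin_le_iff]
  exact fun z hz => hgA z hz


end Final

/-! ### F⁶ᵇ discharged (appended 2026-08-17, lead c4, after the value step F⁶ᵛ `stub_adaptedValueStep` landed) -/

/-- **F⁶ᵇ `stub_abhyankarHigherRankCore` — `LuAlphaPTorsor` along zero-dimensional Abhyankar places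
of ANY rank, every ground field of characteristic `p`, UNCONDITIONALLY** (registered statement of
reshape v6.3 verbatim): `abhyankarHigherRankCore_of_F6v` fed with the landed value step F⁶ᵛ
`stub_adaptedValueStep` (worker w-F6). Ingredients (all landed): F¹ `stub_adaptedUnimodular`,
F³ `stub_adaptedHenselRootChart`, F⁴ᵃ `stub_topCoarsening`, F⁴ᵇ `stub_residualChart`, the level
induction S3* `ap_adaptedPerron_flag`, the UP-lemma, the flag-adapted adjoin-inverse / residue
steps, value torsion, the tower and the absorption. Together with the rank-one
`stub_rankOneAbhyankar` the crux holds along every zero-dimensional ABHYANKAR place — a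
completion-free proof of Cutkosky 2022, Thm. 1.3 for the crux; the named fact
`Cutkosky2022_Thm13` is not used. [cite: Cutkosky2022, Thm. 1.3 (statement only; independent
proof)] -/
theorem stub_abhyankarHigherRankCore :
    ∀ p : ℕ, p.Prime → ∀ (k K : Type) [Field k] [CharP k p] [Field K] [Algebra k K] (O : ValuationSubring K) (A₀ : Subalgebra k K) (h₀ : A₀.toSubring ≤ O.toSubring) (t : K), A₀.FG → ∀ (htp : t ^ p ∈ A₀), IsFractionRing (Algebra.adjoin k (insert t (A₀ : Set K))) K → IsRegularLocalRing (Localization.AtPrime (Ideal.comap (Subring.inclusion h₀) (IsLocalRing.maximalIdeal O))) → (Ideal.comap (Subring.inclusion h₀) (IsLocalRing.maximalIdeal O)).IsMaximal → (∀ x : K, x ∈ O → ∃ f : Polynomial k, f ≠ 0 ∧ Polynomial.aeval x f ∈ O.nonunits) → ¬ ringKrullDim (Localization.AtPrime (Ideal.comap (Subring.inclusion h₀) (IsLocalRing.maximalIdeal O))) ≤ 2 → Literature.AlgebraicGeometry.Resolution.IsAbhyankarPlace O (algebraMap k K).fieldRange ⊤ → ¬ (∀ z w : K, O.valuation z < 1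 → w ≠ 0 → ∃ N : ℕ, O.valuation z ^ N < O.valuation w) → ¬ Literature.AlgebraicGeometry.Resolution.SeparablyGeneratedOver (Literature.AlgebraicGeometry.Resolution.resField O (algebraMap k K).fieldRange) (Literature.AlgebraicGeometry.Resolution.resField O ⊤) → ¬ Literature.AlgebraicGeometry.Resolution.SeparablyGeneratedOver (Literature.AlgebraicGeometry.Resolution.resField O (algebraMap k K).fieldRange) (Literature.AlgebraicGeometry.Resolution.resField O (Subfield.closure (A₀ : Set K))) → ¬ PerfectField k → ¬ (∃ π : K, π ≠ 0 ∧ O.valuation π < 1 ∧ ∀ z : K, z ≠ 0 → ∃ n : ℤ, O.valuation z = O.valuation π ^ n) → (∀ δ : Derivation ℤ (Localization.AtPrime (Ideal.comap (Subring.inclusion h₀) (IsLocalRing.maximalIdeal O))) (Localization.AtPrime (Ideal.comap (Subring.inclusion h₀) (IsLocalRing.maximalIdeal O))), ¬ IsUnit (δ (algebraMap A₀.toSubring (Localization.AtPrime (Ideal.comap (Subring.inclusion h₀) (IsLocalRing.maximalIdeal O))) ⟨t ^ p, htp⟩))) → (∀ c : Localization.AtPrime (Ideal.comap (Subring.inclusion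 h₀) (IsLocalRing.maximalIdeal O)), algebraMap A₀.toSubring (Localization.AtPrime (Ideal.comap (Subring.inclusion h₀) (IsLocalRing.maximalIdeal O))) ⟨t ^ p, htp⟩ ≠ c ^ p) → ∃ (A : Subalgebra k K) (h : A.toSubring ≤ O.toSubring), A₀ ≤ A ∧ t ∈ A ∧ A.FG ∧ IsFractionRing A K ∧ IsRegularLocalRing (Localization.AtPrime (Ideal.comap (Subring.inclusion h) (IsLocalRing.maximalIdeal O))) :=
  abhyankarHigherRankCore_of_F6v stub_adaptedValueStep

/-- **Relative local uniformization at every zero-dimensional Abhyankar place of ANY rank of a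
function field over ANY ground field of characteristic `p`**, unconditionally: every finitely
generated `S ⊆ O` is dominated by a finitely generated `A ⊆ O` with `Frac A = K`, regular at the
centre of `O`. [cite: Cutkosky2022, Thm. 1.3 (statement only; independent proof)] -/
theorem relLU_zeroDim_abhyankar : ∀ p : ℕ, p.Prime → ∀ (k K : Type) [Field k] [CharP k p] [Field K] [Algebra k K] (O : ValuationSubring K), (∀ c : k, algebraMap k K c ∈ O) → (⊤ : IntermediateField k K).FG → (∀ x : K, x ∈ O → ∃ f : Polynomial k, f ≠ 0 ∧ Polynomial.aeval x f ∈ O.nonunits) → Literature.AlgebraicGeometry.Resolution.IsAbhyankarPlace O (algebraMap k K).fieldRange ⊤ → ∀ (S : Subalgebra k K), S.FG → S.toSubring ≤ O.toSubring → ∃ (A : Subalgebra k K) (h : A.toSubring ≤ O.toSubring), S ≤ A ∧ A.FG ∧ IsFractionRing A K ∧ IsRegularLocalRing (Localization.AtPrime (Ideal.comap (Subring.inclusion h) (IsLocalRing.maximalIdeal O))) :=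
  relLU_zeroDim_abhyankar_of_F6v stub_adaptedValueStep

end Summit.ResolutionOfSingularities.ResolutionOfSingularities.Theorems.PfaffLine
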